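import Mathlib
import Summits.Schanuel.Schanuel.Theses.RecursiveCore
import Summits.Schanuel.Schanuel.Theorems.RoyCriterionSchanuelTwoLineSketch
import Summits.Schanuel.Schanuel.Theorems.AclSubsetLogFreeCore.Negative.StandardKernelTwistLinear
import Literature.Barriers.Schanuel.AlgebraicIndependenceOfLogarithms
import Literature.Barriers.Schanuel.NesterenkoModularScopeConjectureProofs
import Literature.Barriers.Schanuel.LargeTranscendenceDegree
import Literature.NumberTheory.Transcendental.LindemannWeierstrassProofs
import Literature.NumberTheory.Transcendental.SchanuelSectorSplit

/-!
# Strategy-census certificates — crux `RecursiveSchanuel` (item stmt-Schanuel-12193, route `RecursiveCore`)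

Crux-strategist seat `planner-cstrat-stmt-Schanuel-12193-r1-0` (REDIRECT r1, 2026-08-17). Sorry-free
certificates backing `Cruxes/RecursiveSchanuel/STRATEGY-CENSUS.md`. The crux (fixed, the route's decl):

`RecursiveSchanuel := ∀ n (z : Fin n → ℂ), LinearIndependent ℚ z →
  (∀ i, IsAlgebraic ℚ(z) (e^{z i})) → AlgebraicIndependent ℚ z`

— Schanuel's conjecture RESTRICTED to the stratum of "recursive" tuples (every `e^{zᵢ}` algebraic over
`ℚ(z₁,…,zₙ)`, i.e. fibre excess `trdeg_{ℚ(z)} ℚ(z, e^z) = 0`).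

What is certified here (all kernel-checked, no `sorry`):

* §0 `crux_iff_forall_rank`, `cruxAtRank_iff_schanuelOnRecursive`: the crux IS Schanuel's inequality on the
  recursive stratum, rank by rank; `crux_of_schanuel`: S → C (the crux is a consequence of the summit).
* §1 ranks 0, 1 are theorems (`cruxAtRank_zero`, `cruxAtRank_one` = Hermite–Lindemann); **rank 2 of the crux is
  EXACTLY Schanuel at rank 2**: `cruxAtRank_two_iff_schanuelTwo : CruxAtRank 2 ↔ SchanuelTwo` (the exhausted shared
  crux stmt-Schanuel-0069 of routes RoyCriterion/EclCore) and `cruxAtRank_two_iff_schanuelRank_two`. The recursive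
  restriction is EMPTY at the first open rank: off the recursive stratum a `ℚ`-free pair is settled by
  Lindemann–Weierstrass or by a two-step tower count. Hence `schanuelTwo_of_crux`, `expOnePi_of_crux` (e ⊥ π).
* §2 `cruxAtRank_of_succ : CruxAtRank (n+1) → CruxAtRank n` (pad a recursive tuple with `log p`, `p` a prime
  outside its `ℚ`-span): failure ranks form an up-set, so EVERY TAIL `∀ n ≥ N, CruxAtRank n` IS THE WHOLE CRUX
  (`tail_iff_crux`) — the "rank split" `SchanuelTwo ∧ Tail₃` is a costume split (`crux_iff_schanuelTwo_and_tail`,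
  `tail_three_iff_crux`).
* §3 `algIndepLogarithms_of_crux`: the catalogued barrier conjecture `AlgIndepLogarithms` (algebraic independence
  of logarithms of algebraic numbers, every rank) sits inside the crux.

References: Lang 1966 pp. 30–31 / Waldschmidt 2000 Conj. 1.14 (Schanuel); Baker 1975 Thm 1.4 (LW), Thm 1.2 (HL);
Roy 2001 Conj. 1 (`SchanuelRank`); tree: `Theorems/RoyCriterionSchanuelTwoLineSketch.lean` (p89549),
`Literature/Barriers/Schanuel/AlgebraicIndependenceOfLogarithms.lean`, `Cruxes/RecursiveSchanuel/Lines/birth.lean`.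
-/

noncomputable section

set_option linter.dupNamespace false

namespace Summit.Schanuel.Schanuel.Cruxes.RecursiveSchanuel.StrategyCensus

open Summit.Schanuel.Schanuel.Theses.RecursiveCore (RecursiveSchanuel)
open Summit.Schanuel.Schanuel.Theses.RoyCriterion (SchanuelTwo)
open Summit.Schanuel.Schanuel.Theorems (schanuelTwo_iff_schanuelRank_two
  expOnePiAlgebraicIndependent_of_schanuelTwo)
open Literature.Barriers.Schanuel (AlgIndepLogarithms algebraicIndependent_of_le_trdeg_adjoin
  trdeg_adjoin_union_eq_of_isAlgebraic_adjoin trdeg_mono)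
open Literature.NumberTheory.Transcendental (SchanuelRank le_trdeg_adjoin_of_algebraicIndependent'
  algebraicIndependent_exp_holds transcendental_exp_holds ExpOnePiAlgebraicIndependent)
open Complex IntermediateField Set Function

/-! ## §0 The crux rank by rank; the crux is Schanuel's inequality on the recursive stratum -/

/-- The crux at one rank `n`: a `ℚ`-free recursive `n`-tuple is algebraically independent. -/
def CruxAtRank (n : ℕ) : Prop :=
  ∀ (z : Fin n → ℂ), LinearIndependent ℚ z →
    (∀ i, IsAlgebraic (adjoin ℚ (range z)) (cexp (z i))) → AlgebraicIndependent ℚ z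

/-- Schanuel's inequality at rank `n` RESTRICTED to recursive tuples (the summit's own format,
`Literature.NumberTheory.Transcendental.SchanuelRank n`, with the recursive hypothesis inserted). -/
def SchanuelOnRecursive (n : ℕ) : Prop :=
  ∀ (z : Fin n → ℂ), LinearIndependent ℚ z →
    (∀ i, IsAlgebraic (adjoin ℚ (range z)) (cexp (z i))) →
      (n : Cardinal) ≤ Algebra.trdeg ℚ (adjoin ℚ (range z ∪ range (cexp ∘ z)))

/-- The crux, by name, is the conjunction of its ranks. -/
theorem crux_iff_forall_rank : RecursiveSchanuel ↔ ∀ n, CruxAtRank n := Iff.rfl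

/-- On a recursive tuple the exponentials add no transcendence: `trdeg ℚ(z, e^z) = trdeg ℚ(z)`.
[folklore] -/
theorem trdeg_eq_of_recursive {n : ℕ} (z : Fin n → ℂ)
    (hrec : ∀ i, IsAlgebraic (adjoin ℚ (range z)) (cexp (z i))) :
    Algebra.trdeg ℚ (adjoin ℚ (range z ∪ range (cexp ∘ z))) =
      Algebra.trdeg ℚ (adjoin ℚ (range z)) :=
  trdeg_adjoin_union_eq_of_isAlgebraic_adjoin _ _ (by rintro _ ⟨i, rfl⟩; exact hrec i)

/-- **The crux at rank `n` ⟺ Schanuel's inequality at rank `n` on the recursive stratum.** -/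
theorem cruxAtRank_iff_schanuelOnRecursive (n : ℕ) : CruxAtRank n ↔ SchanuelOnRecursive n := by
  constructor
  · intro h z hli hrec
    have h1 := le_trdeg_adjoin_of_algebraicIndependent' (h z hli hrec)
    rw [Fintype.card_fin] at h1
    exact h1.trans (trdeg_mono (adjoin.mono ℚ _ _ subset_union_left))
  · intro h z hli hrec
    exact algebraicIndependent_of_le_trdeg_adjoin z
      ((h z hli hrec).trans_eq (trdeg_eq_of_recursive z hrec))

/-- Schanuel at rank `n` restricts to the recursive stratum. -/
theorem schanuelOnRecursive_of_schanuelRank {n : ℕ} (h : SchanuelRank n) : SchanuelOnRecursive n :=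
  fun z hli _ => h z hli

/-- **S → C, rank by rank.** -/
theorem cruxAtRank_of_schanuelRank {n : ℕ} (h : SchanuelRank n) : CruxAtRank n :=
  (cruxAtRank_iff_schanuelOnRecursive n).2 (schanuelOnRecursive_of_schanuelRank h)

/-- **S → C**: the crux is a consequence of the summit (re-derivation of the route's support
`SplitOfSchanuel`, first conjunct, and of the refuter's `recursiveSchanuel_of_schanuel`). -/
theorem crux_of_schanuel (h : _root_.Schanuel) : RecursiveSchanuel :=
  fun n => cruxAtRank_of_schanuelRank (h n)

/-! ## §1 Ranks 0 and 1 are theorems; rank 2 is exactly Schanuel at rank 2 -/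

/-- Rank 0 (empty tuple). -/
theorem cruxAtRank_zero : CruxAtRank 0 := fun z _ _ =>
  (algebraicIndependent_empty_type_iff (R := ℚ) (x := z)).2 (algebraMap ℚ ℂ).injective

/-- Rank 1 is Hermite–Lindemann: if `z ≠ 0` and `e^z` is algebraic over `ℚ(z)`, then `z` is
transcendental (were `z` algebraic, `e^z` would be algebraic over `ℚ`). [cite: BakerTNT1975, Thm 1.2] -/
theorem cruxAtRank_one : CruxAtRank 1 := by
  intro z hli hrec
  have hz0 : z 0 ≠ 0 := hli.ne_zero 0
  have htr : Transcendental ℚ (z 0) := by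
    intro halg
    haveI : Algebra.IsAlgebraic ℚ (adjoin ℚ (range z)) :=
      isAlgebraic_adjoin fun x hx => by
        obtain ⟨i, rfl⟩ := hx
        rw [Subsingleton.elim i 0]
        exact halg.isIntegral
    exact transcendental_exp_holds halg hz0 ((hrec 0).restrictScalars ℚ)
  exact (algebraicIndependent_singleton_iff (0 : Fin 1)).2 htr

/-- `trdeg_K K(S)(T) = trdeg_K K(S ∪ T)` (`K(S)(T) = K(S ∪ T)` as `K`-algebras). [folklore] -/
theorem trdeg_adjoin_adjoin {K E : Type*} [Field K] [Field E] [Algebra K E] (S T : Set E) :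
    Algebra.trdeg K (adjoin (adjoin K S) T) = Algebra.trdeg K (adjoin K (S ∪ T)) := by
  rw [← (equivOfEq (adjoin_adjoin_left K S T)).trdeg_eq]
  rfl

/-- Two-step tower count: if `a ∈ S` is transcendental over `K` and `b ∈ T` is transcendental over
`K(S)`, then `trdeg_K K(S ∪ T) ≥ 2` (`trdeg K(S ∪ T) = trdeg K(S) + trdeg_{K(S)} K(S)(T) ≥ 1 + 1`).
[folklore] -/
theorem two_le_trdeg_adjoin_union {K E : Type*} [Field K] [Field E] [Algebra K E] {S T : Set E}
    {a b : E} (haS : a ∈ S) (ha : Transcendental K a) (hbT : b ∈ T)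
    (hb : Transcendental (adjoin K S) b) :
    (2 : Cardinal) ≤ Algebra.trdeg K (adjoin K (S ∪ T)) := by
  haveI : FaithfulSMul (adjoin K S) (adjoin (adjoin K S) T) :=
    (faithfulSMul_iff_algebraMap_injective (adjoin K S) (adjoin (adjoin K S) T)).mpr
      (algebraMap (adjoin K S) (adjoin (adjoin K S) T)).injective
  have htower := trdeg_add_eq K (adjoin K S) (A := adjoin (adjoin K S) T)
  have ha' : Transcendental K (⟨a, subset_adjoin K S haS⟩ : adjoin K S) := fun h =>
    ha (IntermediateField.isAlgebraic_iff.mp h)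
  haveI : Algebra.Transcendental K (adjoin K S) := ⟨⟨_, ha'⟩⟩
  have hb' : Transcendental (adjoin K S) (⟨b, subset_adjoin (adjoin K S) T hbT⟩ :
      adjoin (adjoin K S) T) := fun h =>
    hb (IntermediateField.isAlgebraic_iff.mp h)
  haveI : Algebra.Transcendental (adjoin K S) (adjoin (adjoin K S) T) := ⟨⟨_, hb'⟩⟩
  have h1 : (1 : Cardinal) ≤ Algebra.trdeg K (adjoin K S) :=
    Cardinal.one_le_iff_pos.mpr (trdeg_pos K (adjoin K S))
  have h2 : (1 : Cardinal) ≤ Algebra.trdeg (adjoin K S) (adjoin (adjoin K S) T) :=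
    Cardinal.one_le_iff_pos.mpr (trdeg_pos (adjoin K S) (adjoin (adjoin K S) T))
  calc (2 : Cardinal) = 1 + 1 := by norm_num
    _ ≤ Algebra.trdeg K (adjoin K S) + Algebra.trdeg (adjoin K S) (adjoin (adjoin K S) T) :=
        add_le_add h1 h2
    _ = Algebra.trdeg K (adjoin (adjoin K S) T) := htower
    _ = Algebra.trdeg K (adjoin K (S ∪ T)) := trdeg_adjoin_adjoin S T

/-- **Crux at rank 2 ⟹ Schanuel at rank 2** (`SchanuelTwo`, item stmt-Schanuel-0069). For a `ℚ`-free pair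
`y`: if `y` is recursive the crux gives `trdeg ℚ(y) = 2`; otherwise some `e^{y_j}` is transcendental over
`ℚ(y)`, and then either both `yᵢ` are algebraic (Lindemann–Weierstrass: `e^{y₁}, e^{y₂}` algebraically
independent) or some `yᵢ` is transcendental (tower count `1 + 1`). So the recursive restriction is EMPTY at
rank 2. [cite: BakerTNT1975, Thm 1.4] -/
theorem schanuelTwo_of_cruxAtRank_two (h : CruxAtRank 2) : SchanuelTwo := by
  intro y hy
  by_cases hA : ∀ i, IsAlgebraic (adjoin ℚ (range y)) (cexp (y i))
  · have h2 := le_trdeg_adjoin_of_algebraicIndependent' (h y hy hA)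
    rw [Fintype.card_fin, Nat.cast_ofNat] at h2
    exact h2.trans (trdeg_mono (adjoin.mono ℚ _ _ subset_union_left))
  · push Not at hA
    obtain ⟨j, hj⟩ := hA
    by_cases hB : ∀ i, IsAlgebraic ℚ (y i)
    · have hind : AlgebraicIndependent ℚ fun i => cexp (y i) :=
        algebraicIndependent_exp_holds y hB hy
      have h2 := le_trdeg_adjoin_of_algebraicIndependent' hind
      rw [Fintype.card_fin, Nat.cast_ofNat] at h2
      exact h2.trans (trdeg_mono (adjoin.mono ℚ _ _ subset_union_right))
    · push Not at hB
      obtain ⟨i, hi⟩ := hB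
      exact two_le_trdeg_adjoin_union ⟨i, rfl⟩ hi ⟨j, rfl⟩ hj

/-- Schanuel at rank 2 ⟹ the crux at rank 2 (restriction, via `SchanuelTwo ↔ SchanuelRank 2`). -/
theorem cruxAtRank_two_of_schanuelTwo (h : SchanuelTwo) : CruxAtRank 2 :=
  cruxAtRank_of_schanuelRank (schanuelTwo_iff_schanuelRank_two.1 h)

/-- **RANK 2 OF THE CRUX IS EXACTLY SCHANUEL AT RANK 2** (the exhausted shared crux `SchanuelTwo`,
stmt-Schanuel-0069: e ⊥ π, π ⊥ log 2, (e, e²)-type planes, fixed-point pairs …). -/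
theorem cruxAtRank_two_iff_schanuelTwo : CruxAtRank 2 ↔ SchanuelTwo :=
  ⟨schanuelTwo_of_cruxAtRank_two, cruxAtRank_two_of_schanuelTwo⟩

/-- Same, in the summit's rank format `SchanuelRank 2` (Roy 2001, Conjecture 1 at `l = 2`).
[cite: Roy2001, Conjecture 1] -/
theorem cruxAtRank_two_iff_schanuelRank_two : CruxAtRank 2 ↔ SchanuelRank 2 :=
  cruxAtRank_two_iff_schanuelTwo.trans schanuelTwo_iff_schanuelRank_two

/-- **The crux contains `SchanuelTwo`.** -/
theorem schanuelTwo_of_crux (hR : RecursiveSchanuel) : SchanuelTwo :=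
  schanuelTwo_of_cruxAtRank_two (hR 2)

/-- **The crux contains the algebraic independence of `e` and `π`** (through `SchanuelTwo`, tree theorem
`expOnePiAlgebraicIndependent_of_schanuelTwo`, p89549). [cite: BakerTNT1975, Ch. 12 p. 120] -/
theorem expOnePi_of_crux (hR : RecursiveSchanuel) : ExpOnePiAlgebraicIndependent :=
  expOnePiAlgebraicIndependent_of_schanuelTwo (schanuelTwo_of_crux hR)

/-! ## §2 Failure ranks form an up-set: every tail is the whole crux -/

/-- Algebraicity passes up along `F ≤ E` (map the polynomial; verbatim the lemma of
`Theorems/AclSubsetLogFreeCore/Negative/LogFreeCoreObjects.lean`). [folklore] -/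
theorem isAlgebraic_of_le {F E : IntermediateField ℚ ℂ} (h : F ≤ E) {w : ℂ}
    (hw : IsAlgebraic F w) : IsAlgebraic E w := by
  obtain ⟨p, hp0, hpw⟩ := hw
  refine ⟨p.map (IntermediateField.inclusion h).toRingHom, ?_, ?_⟩
  · exact (Polynomial.map_ne_zero_iff (IntermediateField.inclusion h).injective).2 hp0
  · rw [Polynomial.aeval_def, Polynomial.eval₂_map]
    rw [Polynomial.aeval_def] at hpw
    have hcomp : (algebraMap E ℂ).comp (IntermediateField.inclusion h).toRingHom =
        algebraMap F ℂ := by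
      ext x; rfl
    rw [hcomp]; exact hpw

/-- For every finite tuple `z` some `log p`, `p` prime, lies outside `span_ℚ(z)` (the `log p` are
`ℚ`-linearly independent — unique factorisation, tree theorem
`StandardKernelTwist.linearIndependent_log_primes` — and there are infinitely many primes). [folklore] -/
theorem exists_log_prime_not_mem_span {n : ℕ} (z : Fin n → ℂ) :
    ∃ p : Nat.Primes, ((Real.log (p : ℕ) : ℝ) : ℂ) ∉ Submodule.span ℚ (range z) := by
  by_contra h
  push Not at h
  haveI : Finite Nat.Primes :=
    LinearIndependent.finite_of_le_span_finite _
      Summit.Schanuel.Schanuel.Theorems.AclSubsetLogFreeCore.Negative.StandardKernelTwist.linearIndependent_log_primes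
      (range z) (by rintro _ ⟨p, rfl⟩; exact h p)
  exact not_finite Nat.Primes

/-- **Padding with a logarithm of a prime**: `CruxAtRank (n + 1) → CruxAtRank n`. Given a `ℚ`-free
recursive `n`-tuple `z`, choose a prime `p` with `log p ∉ span_ℚ(z)`; then `(log p, z)` is `ℚ`-free and
recursive (`e^{log p} = p`), so the crux at rank `n + 1` makes it — hence its sub-family `z` —
algebraically independent. So the failure ranks of the crux form an up-set. [folklore] -/
theorem cruxAtRank_of_succ {n : ℕ} (h : CruxAtRank (n + 1)) : CruxAtRank n := by
  intro z hli hrec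
  obtain ⟨p, hp⟩ := exists_log_prime_not_mem_span z
  set w : ℂ := ((Real.log (p : ℕ) : ℝ) : ℂ) with hw
  set z' : Fin (n + 1) → ℂ := Fin.cons w z with hz'
  have hli' : LinearIndependent ℚ z' := linearIndependent_finCons.2 ⟨hli, hp⟩
  have hsub : range z ⊆ range z' := by
    rintro _ ⟨i, rfl⟩
    exact ⟨i.succ, by simp [hz']⟩
  have hle : adjoin ℚ (range z) ≤ adjoin ℚ (range z') := adjoin.mono ℚ _ _ hsub
  have hpos : (0 : ℝ) < (p : ℕ) := Nat.cast_pos.2 p.2.pos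
  have hrec' : ∀ i, IsAlgebraic (adjoin ℚ (range z')) (cexp (z' i)) := by
    refine Fin.cases ?_ (fun i => ?_)
    · have hexp : cexp (z' 0) = ((p : ℕ) : ℂ) := by
        simp only [hz', Fin.cons_zero, hw, ← Complex.ofReal_exp, Real.exp_log hpos,
          Complex.ofReal_natCast]
      rw [hexp]
      exact isAlgebraic_nat _
    · simpa [hz'] using isAlgebraic_of_le hle (hrec i)
  have hind := h z' hli' hrec'
  have hz : z = z' ∘ Fin.succ := by
    ext i
    simp [hz']
  rw [hz]
  exact hind.comp _ (Fin.succ_injective n)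

/-- Downward closure of truth: `CruxAtRank n → CruxAtRank m` for `m ≤ n`. -/
theorem cruxAtRank_anti {m n : ℕ} (hmn : m ≤ n) (h : CruxAtRank n) : CruxAtRank m := by
  induction hmn with
  | refl => exact h
  | step _ ih => exact ih (cruxAtRank_of_succ h)

/-- **Every tail is the whole crux**: for every `N`, `(∀ n ≥ N, CruxAtRank n) ↔ RecursiveSchanuel`.
So a "rank split" `(ranks < N) ∧ (ranks ≥ N)` of the crux is a costume split: its second piece alone is
the crux. -/
theorem tail_iff_crux (N : ℕ) : (∀ n, N ≤ n → CruxAtRank n) ↔ RecursiveSchanuel := by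
  constructor
  · intro h n
    by_cases hn : N ≤ n
    · exact h n hn
    · exact cruxAtRank_anti (le_of_lt (not_le.1 hn)) (h N le_rfl)
  · intro h n _
    exact h n

/-- The tail from rank 3 is the crux. -/
theorem tail_three_iff_crux : (∀ n, 3 ≤ n → CruxAtRank n) ↔ RecursiveSchanuel := tail_iff_crux 3

/-- The rank decomposition `RecursiveSchanuel ↔ SchanuelTwo ∧ (tail from 3)` — exact, assembly by
`cruxAtRank_anti`; recorded to show WHY it is not filed as a split: by `tail_three_iff_crux` its second
piece is the crux itself. -/
theorem crux_iff_schanuelTwo_and_tail :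
    RecursiveSchanuel ↔ SchanuelTwo ∧ ∀ n, 3 ≤ n → CruxAtRank n :=
  ⟨fun h => ⟨schanuelTwo_of_crux h, fun n _ => h n⟩, fun h => tail_three_iff_crux.1 h.2⟩

/-! ## §3 The catalogued barrier conjecture sits inside the crux, at every rank -/

/-- **The crux contains the algebraic independence of logarithms of algebraic numbers**
(`Literature.Barriers.Schanuel.AlgIndepLogarithms`; = the route's support `LogSectorInside`, = crux
`LogSector` of routes LogPatterns / MatrixCoefficients / ExpMordellWeil): a tuple of logarithms of
algebraic numbers is recursive. [cite: Waldschmidt2000, Conj. 1.15] -/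
theorem algIndepLogarithms_of_crux (hR : RecursiveSchanuel) : AlgIndepLogarithms :=
  fun n l halg hli => hR n l hli fun i => (halg i).tower_top (L := adjoin ℚ (range l))

/-- Rank by rank: the crux at rank `n` contains `AlgIndepLogarithms` at rank `n` (rank 2 ∋ π ⊥ log 2,
`log 2 ⊥ log 3`; the four-exponentials conjecture sits at rank ≤ 4). -/
theorem algIndepLogarithms_rank_of_cruxAtRank {n : ℕ} (h : CruxAtRank n) (l : Fin n → ℂ)
    (halg : ∀ i, IsAlgebraic ℚ (cexp (l i))) (hli : LinearIndependent ℚ l) :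
    AlgebraicIndependent ℚ l :=
  h l hli fun i => (halg i).tower_top (L := adjoin ℚ (range l))

end Summit.Schanuel.Schanuel.Cruxes.RecursiveSchanuel.StrategyCensus

end
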